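import Literature.AlgebraicGeometry.Hu2025.Statements.S05ThetaBlowups.R106dThetaEquations
import Literature.AlgebraicGeometry.Hu2025.Proofs.S05ThetaBlowups.Disp516Word
/-!
# Hu 2025 §5.4 Prop. 5.16 — KERNEL DISCHARGE on the typed carrier (row 106d): the DISPLAYED equations (A)/(B) ARE the
# Def. 5.13 transforms

M-HU PREP by res-type-023 (gen 9), 2026-08-27 — FILED by res-type-055 (gen 9) as PARTITION-HU §3b HELPER for the row-106 owner res-type-023 (author of record; res-plan-2 IDLE POOL DEAL #4b 2026-08-27T08:54:38Z; helper TAKING 08:56:19Z, no objection) from the owner's deposited copy of record HOME/plan/tools/res-type-023/hu/file/Disp516.lean sha16 70b4a13281a1f82b, UNCHANGED except this filing note; S files R106cThetaBlowups = p518536 · R106dThetaEquations = p521266; Proofs chain Charts = p514775 · Prop511 = p519351 · Prop511L = p523180 · Cor518 = p524076 · Disp516Word = p524851 (target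
`Literature/AlgebraicGeometry/Hu2025/Proofs/S05ThetaBlowups/Disp516.lean`, kind proof, after rows 106a–d land). Theorems about OUR
carriers; nothing of [Hu25] is asserted. AI work, weaker than expert review.

Prop. 5.16 (C38L124–C39L17) lists, among the defining relations of `Ṽ_{ϑ[k]} ∩ 𝔙`, the DISPLAYED forms of the block-`F_k` relations:
(A) `B_{𝔙,(s_{F_k},s)} = x_{𝔙,(u_s,v_s)} x_{𝔙,u_k} − x̃_{𝔙,u_s} x̃_{𝔙,v_s}` and `L_{𝔙,F_k} = sgn(s_F) δ_{𝔙,(m,u_k)} + Σ sgn(s) x_{𝔙,(u_s,v_s)}`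
when `(m,u_k) ∈ Λ^o` or `𝔙` is ϱ-standard (C38L137–L141), (B) `B_{𝔙,(s_{F_k},s)} = x_{𝔙,(u_s,v_s)} − x_{𝔙,(m,u_k)} x̃_{𝔙,u_s} x̃_{𝔙,v_s}`
and `L_{𝔙,F_k} = sgn(s_F) ε_{𝔙,u_k} x_{𝔙,(m,u_k)} + Σ …` when `𝔙` is ϖ-standard (C39L4–L8), where `x̃_{𝔙,w} = π^*_{𝔙,𝔙_[0]} x_{𝔙_[0],w}`
(C38L147–L151). Row 106d types the displays as `Prop5_16_dispGov` / `Prop5_16_dispLin` and the Def. 5.13 transforms as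
`ThetaFrame.govAt` / `ThetaFrame.linAt`. PROVED HERE, for every frame satisfying the standing facts (i)/(iv) of `ThetaFrame.IsStandard`
(`u_k` distinct; block bookkeeping of the ϱ-coordinates), every ring, every word `c`, every block `j` and term `τ`:
`Prop5_16_dispGov Φ R c j τ = (Φ.govAt c (j+1) j τ).toPoly` (`dispGov_eq_govAt`) and `Prop5_16_dispLin Φ R c j = Φ.linAt R c (j+1) j`
(`dispLin_eq_linAt`) — i.e. the printed displays (A)/(B) are exactly the iterated term-wise proper transforms (Def. 5.4/5.13) of
`B_(jτ)` and the pull-back of `L_{𝔙_[0],F_j}` on the typed carrier, the division by `ζ^{l_{φ,B}}` at the own block being by `ζ¹` in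
both chart kinds (the computation C39L47–L58 / C39L86–L92 of the printed proof). In particular `equationsAt` (the typed LIST of
Prop. 5.16) is the list of Def. 5.13 transforms of all of `eqns0` except `𝓑^ngv_{≤k}`.
-/

noncomputable section

open MvPolynomial

namespace Literature.AlgebraicGeometry.Hu2025.Statements.S05ThetaBlowups

universe u v

variable {R : Type u} [CommRing R] {V : Type v} [DecidableEq V]

namespace ThetaFrame

variable {P : Type v} {Rs : Type v} [DecidableEq P] [DecidableEq Rs] (Φ : ThetaFrame P Rs)

omit [DecidableEq P] [DecidableEq Rs] in
/-- The block list below level `m`, as natural numbers, is `[0,…,m−1]`. [cite: Hu2025, Prop. 5.16 displays (A)/(B), pp. 89–92 (unrefereed preprint arXiv:2507.21400v1 under adjudication, D-0012/D-0089 — kernel support on OUR typed carrier of row 106; nothing of the source asserted)] -/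
theorem map_val_filter_finRange (m : ℕ) (hm : m ≤ Φ.N) :
    ((List.finRange Φ.N).filter fun k : Fin Φ.N => decide (0 ≤ k.val ∧ k.val < m)).map Fin.val = List.range m := by
  have hfun : (fun k : Fin Φ.N => decide (0 ≤ k.val ∧ k.val < m)) = (fun n : ℕ => decide (0 ≤ n ∧ n < m)) ∘ Fin.val := rfl
  rw [hfun, ← List.filter_map, List.map_coe_finRange_eq_range,
    List.filter_congr (fun n _ => show decide (0 ≤ n ∧ n < m) = decide (n < m) by simp), range_filter_lt _ _ hm]

omit [DecidableEq P] [DecidableEq Rs] in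
/-- The block list below level `j+1` is the block list below level `j` followed by `j`. [cite: Hu2025, Prop. 5.16 displays (A)/(B), pp. 89–92 (unrefereed preprint arXiv:2507.21400v1 under adjudication, D-0012/D-0089 — kernel support on OUR typed carrier of row 106; nothing of the source asserted)] -/
theorem filter_finRange_succ (j : Fin Φ.N) :
    ((List.finRange Φ.N).filter fun k : Fin Φ.N => decide (0 ≤ k.val ∧ k.val < j.val + 1)) =
      ((List.finRange Φ.N).filter fun k : Fin Φ.N => decide (0 ≤ k.val ∧ k.val < j.val)) ++ [j] := by
  apply List.map_injective_iff.mpr Fin.val_injective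
  rw [Φ.map_val_filter_finRange _ j.isLt, List.map_append, Φ.map_val_filter_finRange _ (le_of_lt j.isLt), List.map_cons,
    List.map_nil, List.range_succ]

/-- `Φ.seq c 0 (j+1) = Φ.seq c 0 j ++ [step at block j]` (the last ϑ-blow-up of the level-`(j+1)` chart is the one at `F_j`).
[cite: Hu2025, Prop. 5.16 displays (A)/(B), pp. 89–92 (unrefereed preprint arXiv:2507.21400v1 under adjudication, D-0012/D-0089 — kernel support on OUR typed carrier of row 106; nothing of the source asserted)] -/
theorem seq_succ (c : Φ.Chart) (j : Fin Φ.N) :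
    Φ.seq c 0 (j.val + 1) = Φ.seq c 0 j.val ++ (Φ.step c j).toList := by
  simp only [seq, Φ.filter_finRange_succ, List.filterMap_append]
  congr 1

section WithRing

variable (R : Type u) [CommRing R]

/-- `π^*_{𝔙,𝔙_[0]}` at level `j+1` = the step at block `j` (if present on the chart) after `π^*` at level `j` ((fV-fV0) C38L111–L122). [cite: Hu2025, Prop. 5.16 displays (A)/(B), pp. 89–92 (unrefereed preprint arXiv:2507.21400v1 under adjudication, D-0012/D-0089 — kernel support on OUR typed carrier of row 106; nothing of the source asserted)] -/
theorem proj_succ (c : Φ.Chart) (j : Fin Φ.N) (f : MvPolynomial (P ⊕ Rs) R) :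
    Φ.proj R c (j.val + 1) f =
      (Φ.step c j).elim (Φ.proj R c j.val f) fun s => s.pullback (R := R) (Φ.proj R c j.val f) := by
  simp only [proj, seq_succ, ChartSeq.pullback_append]
  cases Φ.step c j <;> rfl

/-- The Def. 5.13 transform at level `j+1` = the term-wise transform at the step of block `j` (if present) of the transform at level `j` (C38L69–L73). [cite: Hu2025, Prop. 5.16 displays (A)/(B), pp. 89–92 (unrefereed preprint arXiv:2507.21400v1 under adjudication, D-0012/D-0089 — kernel support on OUR typed carrier of row 106; nothing of the source asserted)] -/
theorem transformB_succ' (c : Φ.Chart) (j : Fin Φ.N) (B : Binomial (P ⊕ Rs)) :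
    Φ.transformB c (j.val + 1) B =
      (Φ.step c j).elim (Φ.transformB c j.val B) fun s => s.properTransform (Φ.transformB c j.val B) := by
  simp only [transformB, seq_succ]
  cases Φ.step c j with
  | none => simp [ChartSeq.properTransform]
  | some s => simp [ChartSeq.properTransform_append_singleton]

/-- The exponent of the monomial `x̃_{𝔙,w} = π^*_{𝔙,𝔙_[0]} x_{𝔙_[0],w}` (C38L147–L150 «are monomials in Var_𝔙»).
[cite: Hu2025, Prop. 5.16 displays (A)/(B), pp. 89–92 (unrefereed preprint arXiv:2507.21400v1 under adjudication, D-0012/D-0089 — kernel support on OUR typed carrier of row 106; nothing of the source asserted)] -/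
def tildeExp (c : Φ.Chart) (k : ℕ) (w : P) : (P ⊕ Rs) →₀ ℕ :=
  ChartSeq.pullbackExp (Φ.seq c 0 k) (Finsupp.single (Sum.inl w) 1)

/-- `x̃_{𝔙,w}` is a monomial (C38L150 «are monomials in Var_𝔙»), namely the monomial of `tildeExp`. [cite: Hu2025, Prop. 5.16 displays (A)/(B), pp. 89–92 (unrefereed preprint arXiv:2507.21400v1 under adjudication, D-0012/D-0089 — kernel support on OUR typed carrier of row 106; nothing of the source asserted)] -/
theorem xTilde_eq_monomial (c : Φ.Chart) (k : ℕ) (w : P) :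
    Φ.xTilde R c k w = monomial (Φ.tildeExp c k w) 1 := by
  simp only [xTilde, proj, tildeExp]
  exact ChartSeq.pullback_monomial _ _ _

/-- The exponent of `x̃_{𝔙,w}` at level `j+1` from level `j`: pulled back by the step of block `j` if present. [cite: Hu2025, Prop. 5.16 displays (A)/(B), pp. 89–92 (unrefereed preprint arXiv:2507.21400v1 under adjudication, D-0012/D-0089 — kernel support on OUR typed carrier of row 106; nothing of the source asserted)] -/
theorem tildeExp_succ (c : Φ.Chart) (j : Fin Φ.N) (w : P) :
    Φ.tildeExp c (j.val + 1) w = (Φ.step c j).elim (Φ.tildeExp c j.val w) fun s => s.pullbackExp (Φ.tildeExp c j.val w) := by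
  simp only [tildeExp, seq_succ]
  cases Φ.step c j with
  | none => simp [ChartSeq.pullbackExp]
  | some s => simp [ChartSeq.pullbackExp_append_singleton]

omit [DecidableEq P] [DecidableEq Rs] in
/-- The exponent vector of the ϖ-variable `x_w` is the unit vector at `w`. [cite: Hu2025, Prop. 5.16 displays (A)/(B), pp. 89–92 (unrefereed preprint arXiv:2507.21400v1 under adjudication, D-0012/D-0089 — kernel support on OUR typed carrier of row 106; nothing of the source asserted)] -/
theorem eP_eq (w : P) : (eP w : (P ⊕ Rs) →₀ ℕ) = Finsupp.single (Sum.inl w) 1 := rfl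

omit [DecidableEq P] [DecidableEq Rs] in
/-- A variable is the monomial of its unit exponent vector. [cite: Hu2025, Prop. 5.16 displays (A)/(B), pp. 89–92 (unrefereed preprint arXiv:2507.21400v1 under adjudication, D-0012/D-0089 — kernel support on OUR typed carrier of row 106; nothing of the source asserted)] -/
theorem X_eq_monomial' (v : P ⊕ Rs) : (X v : MvPolynomial (P ⊕ Rs) R) = monomial (Finsupp.single v 1) 1 := rfl

omit [DecidableEq P] [DecidableEq Rs] in
/-- The chart value of an optional ϱ-coordinate is the monomial of its (possibly zero) exponent vector. [cite: Hu2025, Prop. 5.16 displays (A)/(B), pp. 89–92 (unrefereed preprint arXiv:2507.21400v1 under adjudication, D-0012/D-0089 — kernel support on OUR typed carrier of row 106; nothing of the source asserted)] -/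
theorem xOpt_eq_monomial (o : Option Rs) : (xOpt R o : MvPolynomial (P ⊕ Rs) R) = monomial (eOpt o) 1 := by
  cases o with
  | none => simp [xOpt, eOpt]
  | some r => rfl

/-! ## The centres of the word below block `j` do not meet the block-`j` data -/

/-- Every step of `Φ.seq c a b` is the step of a block `i` with `a ≤ i < b` and a variable leading ϱ-coordinate.
[cite: Hu2025, Prop. 5.16 displays (A)/(B), pp. 89–92 (unrefereed preprint arXiv:2507.21400v1 under adjudication, D-0012/D-0089 — kernel support on OUR typed carrier of row 106; nothing of the source asserted)] -/
theorem centre_of_mem_seq {c : Φ.Chart} {a b : ℕ} {s : ChartStep (P ⊕ Rs)} (hs : s ∈ Φ.seq c a b) :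
    ∃ i : Fin Φ.N, (a ≤ i.val ∧ i.val < b) ∧ ∃ r, Φ.lead i = some r ∧
      s.centre = {Sum.inl (Φ.ult i), Sum.inr r} ∧ s.exc = (c i).by (Sum.inl (Φ.ult i)) (Sum.inr r) := by
  obtain ⟨i, hi, hstep⟩ := Φ.mem_seq.mp hs
  obtain ⟨r, hr, -⟩ := Φ.exc_of_step hstep
  exact ⟨i, hi, r, hr, Φ.step_spec hr hstep⟩

/-- `x_{u_j}` lies in no centre below block `j` (`u_i ≠ u_j` for `i < j`, C36L120).
[cite: Hu2025, Prop. 5.16 displays (A)/(B), pp. 89–92 (unrefereed preprint arXiv:2507.21400v1 under adjudication, D-0012/D-0089 — kernel support on OUR typed carrier of row 106; nothing of the source asserted)] -/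
theorem ult_not_mem_centre (hult : Function.Injective Φ.ult) {c : Φ.Chart} {j : Fin Φ.N} :
    ∀ s ∈ Φ.seq c 0 j.val, (Sum.inl (Φ.ult j) : P ⊕ Rs) ∉ s.centre := by
  intro s hs hmem
  obtain ⟨i, ⟨-, hij⟩, r, -, hc, -⟩ := Φ.centre_of_mem_seq hs
  rw [hc] at hmem
  simp only [Finset.mem_insert, Sum.inl.injEq, Finset.mem_singleton, reduceCtorEq, or_false] at hmem
  exact absurd (Fin.ext_iff.mp (hult hmem)) (by omega)

/-- `x_{(m,u_j)}` lies in no centre below block `j` (distinct blocks have distinct leading ϱ-coordinates).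
[cite: Hu2025, Prop. 5.16 displays (A)/(B), pp. 89–92 (unrefereed preprint arXiv:2507.21400v1 under adjudication, D-0012/D-0089 — kernel support on OUR typed carrier of row 106; nothing of the source asserted)] -/
theorem lead_not_mem_centre (hblk : ∀ k r, Φ.lead k = some r → Φ.blk r = k) {c : Φ.Chart} {j : Fin Φ.N} {r : Rs}
    (hr : Φ.lead j = some r) : ∀ s ∈ Φ.seq c 0 j.val, (Sum.inr r : P ⊕ Rs) ∉ s.centre := by
  intro s hs hmem
  obtain ⟨i, ⟨-, hij⟩, r', hr', hc, -⟩ := Φ.centre_of_mem_seq hs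
  rw [hc] at hmem
  simp only [Finset.mem_insert, reduceCtorEq, Finset.mem_singleton, Sum.inr.injEq, false_or] at hmem
  subst hmem
  have := (hblk i r hr').symm.trans (hblk j r hr)
  exact absurd (Fin.ext_iff.mp this) (by omega)

/-- The plus term `x_{(u_s,v_s)} x_{u_j}` of `B_(jτ)` meets no centre below block `j`.
[cite: Hu2025, Prop. 5.16 displays (A)/(B), pp. 89–92 (unrefereed preprint arXiv:2507.21400v1 under adjudication, D-0012/D-0089 — kernel support on OUR typed carrier of row 106; nothing of the source asserted)] -/
theorem plus_untouched (hult : Function.Injective Φ.ult) (hblk : ∀ k r, Φ.lead k = some r → Φ.blk r = k)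
    (hterm : ∀ k τ r, Φ.termR k τ = some r → Φ.blk r = k ∧ Φ.lead k ≠ some r)
    {c : Φ.Chart} {j : Fin Φ.N} (τ : Fin (Φ.t j)) :
    ∀ s ∈ Φ.seq c 0 j.val, ∀ v ∈ s.centre, (eOpt (Φ.termR j τ) + eP (Φ.ult j) : (P ⊕ Rs) →₀ ℕ) v = 0 := by
  intro s hs v hv
  have h1 : (eP (Φ.ult j) : (P ⊕ Rs) →₀ ℕ) v = 0 := by
    rw [eP_eq, Finsupp.single_eq_of_ne]
    rintro rfl
    exact Φ.ult_not_mem_centre hult s hs hv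
  have h2 : (eOpt (Φ.termR j τ) : (P ⊕ Rs) →₀ ℕ) v = 0 := by
    cases hρ : Φ.termR j τ with
    | none => simp [eOpt]
    | some ρ =>
      simp only [eOpt, Option.elim_some]
      rw [Finsupp.single_eq_of_ne]
      rintro rfl
      exact Φ.termR_not_mem_centre hblk hterm hρ s hs hv
  simp [h1, h2]

/-- The leading ϱ-coordinate `x_{(m,u_j)}` of block `j` meets no centre below block `j` (exponent form). [cite: Hu2025, Prop. 5.16 displays (A)/(B), pp. 89–92 (unrefereed preprint arXiv:2507.21400v1 under adjudication, D-0012/D-0089 — kernel support on OUR typed carrier of row 106; nothing of the source asserted)] -/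
theorem lead_untouched (hblk : ∀ k r, Φ.lead k = some r → Φ.blk r = k) {c : Φ.Chart} {j : Fin Φ.N} :
    ∀ s ∈ Φ.seq c 0 j.val, ∀ v ∈ s.centre, (eOpt (Φ.lead j) : (P ⊕ Rs) →₀ ℕ) v = 0 := by
  intro s hs v hv
  cases hr : Φ.lead j with
  | none => simp [eOpt]
  | some r =>
    simp only [eOpt, Option.elim_some]
    rw [Finsupp.single_eq_of_ne]
    rintro rfl
    exact Φ.lead_not_mem_centre hblk hr s hs hv

/-- **`B_(jτ)` below its own block:** on the chart of `ℛ̃_{ϑ[j]}` (printed: before the blow-up at `F_{j+1}`… i.e. Lean level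
`j`), `B_{𝔙',(s_F,s)} = x_{(u_s,v_s)} x_{u_j} − x_{(m,u_j)} x̃_{u_s} x̃_{v_s}` — only the ϖ-variables of the minus term were pulled back.
[cite: Hu2025, Prop. 5.16 displays (A)/(B), pp. 89–92 (unrefereed preprint arXiv:2507.21400v1 under adjudication, D-0012/D-0089 — kernel support on OUR typed carrier of row 106; nothing of the source asserted)] -/
theorem transformB_gov0_below (hult : Function.Injective Φ.ult) (hblk : ∀ k r, Φ.lead k = some r → Φ.blk r = k)
    (hterm : ∀ k τ r, Φ.termR k τ = some r → Φ.blk r = k ∧ Φ.lead k ≠ some r)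
    (c : Φ.Chart) (j : Fin Φ.N) (τ : Fin (Φ.t j)) :
    Φ.transformB c j.val (Φ.gov0 j τ) =
      ⟨eOpt (Φ.termR j τ) + eP (Φ.ult j),
        eOpt (Φ.lead j) + (Φ.tildeExp c j.val (Φ.termP₁ j τ) + Φ.tildeExp c j.val (Φ.termP₂ j τ))⟩ := by
  have h := ChartSeq.properTransform_of_plus_untouched (Φ.seq c 0 j.val) (eOpt (Φ.termR j τ) + eP (Φ.ult j))
    (eOpt (Φ.lead j)) (eP (Φ.termP₁ j τ) + eP (Φ.termP₂ j τ)) (Φ.plus_untouched hult hblk hterm τ) (Φ.lead_untouched hblk)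
  rw [ChartSeq.pullbackExp_add] at h
  simp only [transformB, gov0, add_assoc] at h ⊢
  exact h

/-! ## The displayed governing binomial (A)/(B) IS the Def. 5.13 transform -/

/-- **Prop. 5.16, displays (A)/(B) for `B_{𝔙,(s_{F_k},s)}` = the Def. 5.13 transform `govAt`**, on every frame with `u_k` distinct
and the block bookkeeping of `IsStandard` (iv).
[cite: Hu2025, Prop. 5.16 displays (A)/(B), pp. 89–92 (unrefereed preprint arXiv:2507.21400v1 under adjudication, D-0012/D-0089 — kernel support on OUR typed carrier of row 106; nothing of the source asserted)] -/
theorem dispGov_eq_govAt (hult : Function.Injective Φ.ult) (hblk : ∀ k r, Φ.lead k = some r → Φ.blk r = k)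
    (hterm : ∀ k τ r, Φ.termR k τ = some r → Φ.blk r = k ∧ Φ.lead k ≠ some r)
    (c : Φ.Chart) (j : Fin Φ.N) (τ : Fin (Φ.t j)) :
    Prop5_16_dispGov Φ R c j τ = (Φ.govAt c (j.val + 1) j τ).toPoly (R := R) := by
  have hbelow := Φ.transformB_gov0_below hult hblk hterm c j τ
  -- the minus factor `M = x̃_{u_s} x̃_{v_s}` below block j, and its value at `(m,u_j)`
  set M := Φ.tildeExp c j.val (Φ.termP₁ j τ) + Φ.tildeExp c j.val (Φ.termP₂ j τ) with hM
  cases hl : Φ.lead j with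
  | none =>
    have hstep : Φ.step c j = none := Φ.step_of_lead_none hl
    have hgov : Φ.govAt c (j.val + 1) j τ = ⟨eOpt (Φ.termR j τ) + eP (Φ.ult j), M⟩ := by
      rw [govAt, Φ.transformB_succ', hstep, Option.elim_none, hbelow, hl]
      simp [eOpt, hM]
    have ht : ∀ w, Φ.tildeExp c (j.val + 1) w = Φ.tildeExp c j.val w := fun w => by
      rw [Φ.tildeExp_succ, hstep, Option.elim_none]
    simp only [Prop5_16_dispGov, hl, Option.elim_none, hgov, Binomial.toPoly_eq, xOpt_eq_monomial, xTilde_eq_monomial,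
      X_eq_monomial', monomial_mul, one_mul, ht, hM, eP_eq]
  | some r =>
    obtain ⟨s, hstep, hexc⟩ := Φ.step_of_lead_some c hl
    have hcen := (Φ.step_spec hl hstep).1
    have hyd : (Sum.inl (Φ.ult j) : P ⊕ Rs) ≠ Sum.inr r := Sum.inl_ne_inr
    have hAy : (eOpt (Φ.termR j τ) : (P ⊕ Rs) →₀ ℕ) (Sum.inl (Φ.ult j)) = 0 := by
      cases Φ.termR j τ <;> simp [eOpt]
    have hAd : (eOpt (Φ.termR j τ) : (P ⊕ Rs) →₀ ℕ) (Sum.inr r) = 0 := by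
      cases hρ : Φ.termR j τ with
      | none => simp [eOpt]
      | some ρ =>
        simp only [eOpt, Option.elim_some]
        rw [Finsupp.single_eq_of_ne]
        intro h
        have hrr := Sum.inr_injective h
        subst hrr
        exact (hterm j τ _ hρ).2 hl
    have hMd : M (Sum.inr r) = 0 := by
      have hne : ∀ s' ∈ Φ.seq c 0 j.val, (Sum.inr r : P ⊕ Rs) ≠ s'.exc := fun s' hs' h =>
        Φ.lead_not_mem_centre hblk hl s' hs' (h ▸ s'.exc_mem)
      have key : ∀ w, Φ.tildeExp c j.val w (Sum.inr r) = 0 := by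
        intro w
        simp only [tildeExp]
        suffices hh : ∀ (L : ChartSeq (P ⊕ Rs)) (T : (P ⊕ Rs) →₀ ℕ), (∀ s' ∈ L, (Sum.inr r : P ⊕ Rs) ≠ s'.exc) →
            T (Sum.inr r) = 0 → ChartSeq.pullbackExp L T (Sum.inr r) = 0 from
          hh _ _ hne (by rw [Finsupp.single_eq_of_ne]; exact Sum.inr_ne_inl)
        intro L
        induction L with
        | nil => intro T _ hT; exact hT
        | cons s' L ih =>
          intro T hL hT
          rw [ChartSeq.pullbackExp_cons]
          exact ih _ (fun s'' hs'' => hL s'' (by simp [hs''])) (by rw [s'.pullbackExp_apply_of_ne_exc T (hL s' (by simp)), hT])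
      simp [hM, key]
    have ht : ∀ w, Φ.tildeExp c (j.val + 1) w = s.pullbackExp (Φ.tildeExp c j.val w) := fun w => by
      rw [Φ.tildeExp_succ, hstep, Option.elim_some]
    have hMsucc : Φ.tildeExp c (j.val + 1) (Φ.termP₁ j τ) + Φ.tildeExp c (j.val + 1) (Φ.termP₂ j τ) = s.pullbackExp M := by
      rw [ht, ht, hM, s.pullbackExp_add]
    cases hk : c j with
    | varrho =>
      have he : s.exc = Sum.inr r := by rw [hexc, hk, ThetaKind.varrho_by]
      have hgov : Φ.govAt c (j.val + 1) j τ = ⟨eOpt (Φ.termR j τ) + eP (Φ.ult j), s.pullbackExp M⟩ := by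
        rw [govAt, Φ.transformB_succ', hstep, Option.elim_some, hbelow, hl]
        simp only [eOpt, Option.elim_some, eP_eq]
        exact s.properTransform_own_block_rho hyd hcen he _ _ hAy hAd hMd
      simp only [Prop5_16_dispGov, hl, Option.elim_some, hk, ThetaKind.varrho_by, hgov, Binomial.toPoly_eq, xOpt_eq_monomial,
        xTilde_eq_monomial, X_eq_monomial', monomial_mul, one_mul, hMsucc, eP_eq]
    | varpi =>
      have he : s.exc = Sum.inl (Φ.ult j) := by rw [hexc, hk, ThetaKind.varpi_by]
      have hgov : Φ.govAt c (j.val + 1) j τ = ⟨eOpt (Φ.termR j τ), Finsupp.single (Sum.inr r) 1 + s.pullbackExp M⟩ := by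
        rw [govAt, Φ.transformB_succ', hstep, Option.elim_some, hbelow, hl]
        simp only [eOpt, Option.elim_some, eP_eq]
        exact s.properTransform_own_block_pi hyd hcen he _ _ hAy hAd hMd
      simp only [Prop5_16_dispGov, hl, Option.elim_some, hk, ThetaKind.varpi_by, hgov, Binomial.toPoly_eq, xOpt_eq_monomial,
        xTilde_eq_monomial, X_eq_monomial', monomial_mul, one_mul, ← hMsucc, add_assoc]

/-! ## The displayed linearized relation (A)/(B) IS the pull-back `L_{𝔙,F_k}` -/

/-- **Prop. 5.16, displays (A)/(B) for `L_{𝔙,F_k}` = the Def. 5.13 transform `linAt` (pull-back of `L_{𝔙_[0],F_k}`)**, on every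
frame with the block bookkeeping of `IsStandard` (iv).
[cite: Hu2025, Prop. 5.16 displays (A)/(B), pp. 89–92 (unrefereed preprint arXiv:2507.21400v1 under adjudication, D-0012/D-0089 — kernel support on OUR typed carrier of row 106; nothing of the source asserted)] -/
theorem dispLin_eq_linAt (hblk : ∀ k r, Φ.lead k = some r → Φ.blk r = k)
    (hterm : ∀ k τ r, Φ.termR k τ = some r → Φ.blk r = k ∧ Φ.lead k ≠ some r)
    (c : Φ.Chart) (j : Fin Φ.N) :
    Prop5_16_dispLin Φ R c j = Φ.linAt R c (j.val + 1) j := by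
  -- the non-leading coordinates are never moved
  have hterms : ∀ τ, Φ.proj R c (j.val + 1) (xOpt R (Φ.termR j τ)) = xOpt R (Φ.termR j τ) := by
    intro τ
    cases hρ : Φ.termR j τ with
    | none => simp [xOpt]
    | some ρ =>
      simp only [xOpt, Option.elim_some, proj]
      exact ChartSeq.pullback_X_of_forall_not_mem _ (Φ.termR_not_mem_centre hblk hterm hρ)
  have hsum : Φ.proj R c (j.val + 1) (∑ τ : Fin (Φ.t j), Φ.sgnTerm j τ • xOpt R (Φ.termR j τ)) =
      ∑ τ : Fin (Φ.t j), Φ.sgnTerm j τ • xOpt R (Φ.termR j τ) := by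
    rw [map_sum]
    exact Finset.sum_congr rfl fun τ _ => by rw [map_zsmul, hterms]
  cases hl : Φ.lead j with
  | none =>
    have hlead : Φ.proj R c (j.val + 1) (xOpt R (none : Option Rs)) = 1 := by simp [xOpt]
    simp only [Prop5_16_dispLin, hl, Option.elim_none, linAt, lin0, map_add, map_zsmul, hsum]
    rw [hlead]
  | some r =>
    obtain ⟨s, hstep, hexc⟩ := Φ.step_of_lead_some c hl
    have hcen := (Φ.step_spec hl hstep).1
    have hbelow : Φ.proj R c j.val (X (Sum.inr r)) = X (Sum.inr r) :=
      ChartSeq.pullback_X_of_forall_not_mem _ (Φ.lead_not_mem_centre hblk hl)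
    have hmem : (Sum.inr r : P ⊕ Rs) ∈ s.centre := by rw [hcen]; simp
    cases hk : c j with
    | varrho =>
      have he : s.exc = Sum.inr r := by rw [hexc, hk, ThetaKind.varrho_by]
      have hlead : Φ.proj R c (j.val + 1) (xOpt R (some r)) = X (Sum.inr r) := by
        rw [xOpt, Option.elim_some, Φ.proj_succ, hstep, Option.elim_some, hbelow, ← he, s.pullback_X_exc]
      simp only [Prop5_16_dispLin, hl, Option.elim_some, hk, ThetaKind.varrho_by, linAt, lin0, map_add, map_zsmul, hsum]
      rw [hlead]
    | varpi =>
      have he : s.exc = Sum.inl (Φ.ult j) := by rw [hexc, hk, ThetaKind.varpi_by]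
      have hlead : Φ.proj R c (j.val + 1) (xOpt R (some r)) = X (Sum.inl (Φ.ult j)) * X (Sum.inr r) := by
        rw [xOpt, Option.elim_some, Φ.proj_succ, hstep, Option.elim_some, hbelow,
          s.pullback_X_of_mem hmem (by rw [he]; exact Sum.inr_ne_inl), he]
      simp only [Prop5_16_dispLin, hl, Option.elim_some, hk, ThetaKind.varpi_by, linAt, lin0, map_add, map_zsmul, hsum]
      rw [hlead]

/-- **Both displays on a standard frame** (`Φ.IsStandard`: the hypotheses (i) `u_k` distinct and (iv) block bookkeeping are
its first and fourth/fifth conjuncts).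
[cite: Hu2025, Prop. 5.16 displays (A)/(B), pp. 89–92 (unrefereed preprint arXiv:2507.21400v1 under adjudication, D-0012/D-0089 — kernel support on OUR typed carrier of row 106; nothing of the source asserted)] -/
theorem disp_eq_transform_of_isStandard (hstd : Φ.IsStandard) (c : Φ.Chart) (j : Fin Φ.N) :
    (∀ τ, Prop5_16_dispGov Φ R c j τ = (Φ.govAt c (j.val + 1) j τ).toPoly (R := R)) ∧
      Prop5_16_dispLin Φ R c j = Φ.linAt R c (j.val + 1) j :=
  ⟨fun τ => Φ.dispGov_eq_govAt R hstd.1 hstd.2.2.2.1 hstd.2.2.2.2.1 c j τ,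
    Φ.dispLin_eq_linAt R hstd.2.2.2.1 hstd.2.2.2.2.1 c j⟩

end WithRing

end ThetaFrame

end Literature.AlgebraicGeometry.Hu2025.Statements.S05ThetaBlowups

end
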